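import Summits.QuantumFields.BalabanUV.T4Continuum.Spine.NE1p.DressedRebornMuResponseBipencilWitness

/-!
# T⁴ programme, spine estimate NE1′ (node O3b/H2) — WITNESS «LOG-CONVEX ALONG THE REAL SOURCE PENCIL»: W86's liveness of the re-born μ-part
# (`reborn_live`: the second difference of the dressed one-cube output `E[actM s](X₀)` over the sources `0, ¼, ½` is NOT zero) holds at EVERY
# nonnegative real source `t` and EVERY live step `δ` (`t + 2δ ≤ 2`): `1 + a(s) = 1 + cM·(√π + ∫ incr (s·r))` is STRICTLY MIDPOINT-LOG-CONVEX
# in the real source — `(1 + a(t+δ))² < (1 + a(t))·(1 + a(t+2δ))` — because the quadratic form `λ²(1 + a(t)) − 2λ(1 + a(t+δ)) + (1 + a(t+2δ))`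
# is the Gaussian integral of a SUM OF TWO SQUARES `w·[(λ − 1)²∕√π + c·e^{trρ}·(λ − e^{δrρ})²]`; and by W101's mean value face the response of the
# `δ`-re-born part cannot die on ANY real sub-window

Cell `pub-balaban`, sub-cell `t4`, BINDER-OWNERS row NE1′; NE1′ formalisation crew, unit `b2b-balaban-t4-ne1p-formalise-leaf-06`
(LEAF PROVER 06, generation 14); crew row W107 ∕ DAG N29zzzzzy of `t4/formal/NE1p/LEAVES.md` (BOOKED typer R-T156 `HOME/CLAIMS.log`
l.25520 on INTENT l.25397; LANDED p245426 l.25543; cross-read X255 ok (leaf-03-g15); the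
seat's THIRD row after W101 `DressedRebornMuResponseBipencilWitness` (p244815) and W102 `DressedMuWindowSharpnessWitness` (p245020)).  ADDITIVE —
imports W101 `Spine/NE1p/DressedRebornMuResponseBipencilWitness` (this unit, p244815; → W86 → W35 → W33 → W24, W51, S61) ONLY; THEOREMS ONLY (0 def,
0 `def … : Prop`, 0 cite); every toy datum is W86 ∕ W35 ∕ W33 ∕ W24's BY NAME (`actM`, `cM`, `cM_pos`, `incr`, `incr_nonneg_le`, `integrable_incr`,
`integrable_gauss_E1`, `gaussian_E1`, `crd`, `E1`, `X₀`, `exp_locE_cube`, `norm_actM_X₀_lt_one`, `actM_real_X₀`), W51's `analyticEnd_fires` and W101's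
`norm_mixedDiff_le_of_deriv_le` ∕ `differentiableAt_shift_sub` BY NAME; nothing restated.

WHY THIS FILE.  W86 decided the liveness of S56's bilinear END at ONE point — the second difference over `(0, ¼, ½)` — by Cauchy–Schwarz against the
Gaussian weight; W101 turned that one point into «the response is not identically zero on `‖m‖ ≤ ¼`».  The structural fact behind both is that
`s ↦ 1 + a(s) = ∫ e^{−‖v‖²}·(1∕√π + cM·e^{s·r·ρ(v)}) dv` (`ρ(v) = e^{−(v 0)²}`) is a moment-generating-type function, hence LOG-CONVEX in the real
source; here its strict MIDPOINT log-convexity at every equally spaced nonnegative triple is proved WITHOUT Cauchy–Schwarz: the discriminant of a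
positive quadratic form whose density is a sum of two squares (`grep -rn "logConvex\|midpoint" Spine/NE1p` = ∅ before this file).
* §1 [folklore] `incr_add_gauss` (`incr s v + e^{−‖v‖²} = e^{sρ(v)}·e^{−‖v‖²}`), `integral_density` (`∫ i_t = 1 + c·(√π + ∫ incr (t·r))` for the
  density `i_t = e^{−‖v‖²}∕√π + c·(incr (t r) + e^{−‖v‖²})`), `density_quadratic_eq_sos` (THE SUM OF SQUARES, by `ring` after `e^{(t+δ)rρ} =
  e^{trρ}·e^{δrρ}`, `e^{(t+2δ)rρ} = e^{trρ}·(e^{δrρ})²`), `sos_pos` (positive at every `v` for `0 < c`, `0 < δ·r`: at `λ = 1` the second square is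
  live since `e^{δrρ} > 1`, else the first).
* §2 `one_add_act_pos`; **`quadratic_form_pos`** (`0 < λ²(1+a(t)) − 2λ(1+a(t+δ)) + (1+a(t+2δ))` for `0 ≤ t`, `0 < δ`, `0 < r`, every `λ`: linearity of
  the integral + `integral_pos_iff_support_of_nonneg_ae` on the everywhere-positive sum of squares); **`strict_logConvex`** (`λ := (1+a(t+δ))∕(1+a(t))`).
* §3 ON THE TORUS — **`second_difference_live`**: for `0 < r`, `0 ≤ t`, `0 < δ`, `t + 2δ ≤ 2`, `E(t+2δ) − E(t+δ) − (E(t+δ) − E(t)) ≠ 0` for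
  `E(s) = E[actM s](X₀)` (W24 `exp_locE_cube` + W35 `norm_actM_X₀_lt_one` + W86 `actM_real_X₀`, then §2); W86's `reborn_live` RE-DERIVED as the
  instance `(t, δ) = (0, ¼)` (an `example`, casts only); **`response_not_identically_zero_on_window`**: for `t + 2δ < 2` it is false that
  `∂_m (E[actM(m + t + δ)](X₀) − E[actM(m + t)](X₀)) = 0` at every `‖m‖ ≤ δ` (W101's `norm_mixedDiff_le_of_deriv_le` at `C = 0` + `differentiableAt_shift_sub`
  with W51's holomorphy at radius 2) — W101's `response_not_identically_zero` was the window `(t, δ) = (0, ¼)` with base step ¼.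

HONEST FRAMING.  A decided toy on pv22's periodic carrier; [folklore] real analysis only (linearity and positivity of the Bochner integral, a
sum-of-squares identity by `ring`, the discriminant of a positive quadratic form); OUR numbers on OUR toy — the log-convexity is a property of W35's
CHOSEN Gaussian-core activity along W33's live table, NOT a statement about Bałaban's (2.14) densities or any printed constant; it sharpens WHERE
the crew's decided liveness witnesses (W86, W101) are live, it discharges no wall: (B1a) exercised at a TOY core only, (w5)∕(w6) NOT discharged on
Bałaban's densities; (B1b) ∕ (B3) ∕ (B5) untouched ((B3) = G-ne9p2-5 UNPRINTED, shared with NE9); 0 binders instantiated on Bałaban's densities; no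
wall item; the NE1′ wall wording of record v1.8 (T4-DAG v48) — words, not kind — does NOT move; R-t4r2-Q2 NOT met; ABSOLUTE RULE honoured (no numeral
of print; nothing internally minted is cited).  NE1′ ⇐ the named binders — NOT proved, NOT printed; spine PROVED 0∕9; count 9 unchanged.  Rung (B)+1 on
ONE finite four-torus — NOT infinite volume, NOT a mass gap, NOT OS on ℝ⁴, NOT Clay.  HONEST DEPENDENCY: continuum YM on T⁴ ⇐ BetaPertH ∧ nine spine
estimates (0/9 proved); BetaPertH ⇐ (D1) ∧ (D4) ∧ CAP+tail; G-an2-4 gates asym, D1 and NE2/3/4.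
-/

noncomputable section

namespace Summit.QuantumFields.BalabanUV.T4Continuum.NE1p.DressedRebornMuPartLogConvexWitness

open Set Metric MeasureTheory Complex
open scoped BigOperators
open Literature.MathematicalPhysics.QuantumFieldTheory.Balaban1983to89
open Literature.MathematicalPhysics.QuantumFieldTheory.Balaban1983to89.B13Resummation (locE)
open Literature.MathematicalPhysics.QuantumFieldTheory.Balaban1983to89.TreeLengthTorus (TDom tsys)
open Literature.MathematicalPhysics.QuantumFieldTheory.Balaban1983to89.TreeLengthTorusGeometry (tgeometry)
open Summit.QuantumFields.BalabanUV.T4Continuum.NE1p.DressedSmallFieldTorusWitness (X₀ exp_locE_cube)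
open Summit.QuantumFields.BalabanUV.T4Continuum.NE1p.DressedSmallFieldCoresWitness (E1 crd incr incr_nonneg_le integrable_incr
  integrable_gauss_E1 gaussian_E1)
open Summit.QuantumFields.BalabanUV.T4Continuum.NE1p.DressedSmallFieldCoresMassWitness (cM cM_pos actM norm_actM_X₀_lt_one)
open Summit.QuantumFields.BalabanUV.T4Continuum.NE1p.DressedRebornMuPartBipencilWitness (actM_real_X₀)
open Summit.QuantumFields.BalabanUV.T4Continuum.NE1p.DressedSourceAnalyticWitness (analyticEnd_fires)
open Summit.QuantumFields.BalabanUV.T4Continuum.NE1p.DressedRebornMuResponseBipencilWitness (norm_mixedDiff_le_of_deriv_le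
  differentiableAt_shift_sub)

variable (N : ℕ) [NeZero N] (r : ℝ) (hr : 0 ≤ r)

/-! ## §1 The integral representation of `1 + a(t)` and the SUM-OF-SQUARES identity -/

/-- [folklore] The density of `1 + a(t)` along the real source pencil: `w(v)·(1∕√π + c·e^{t·r·ρ(v)})` written with W33's letters,
`i_t(v) := e^{−‖v‖²}∕√π + c·(incr (t·r) v + e^{−‖v‖²})` (`incr s v + e^{−‖v‖²} = e^{s·ρ(v)}·e^{−‖v‖²}`, `ρ(v) = e^{−(v 0)²}`). -/
theorem incr_add_gauss (s : ℝ) (v : E1) :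
    incr s v + Real.exp (-‖v‖ ^ 2) = Real.exp (s * Real.exp (-(crd v ^ 2))) * Real.exp (-‖v‖ ^ 2) := by
  unfold incr; ring

/-- [folklore] `∫ i_t = 1 + a(t)` in W86's closed form `1 + cM·(√π + ∫ incr (t·r))`. -/
theorem integral_density (c t : ℝ) (ht : 0 ≤ t * r) :
    ∫ v : E1, (Real.exp (-‖v‖ ^ 2) / Real.sqrt Real.pi + c * (incr (t * r) v + Real.exp (-‖v‖ ^ 2))) =
      1 + c * (Real.sqrt Real.pi + ∫ v : E1, incr (t * r) v) := by
  have hπ : Real.sqrt Real.pi ≠ 0 := (Real.sqrt_pos.2 Real.pi_pos).ne'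
  have h1 : Integrable (fun v : E1 => Real.exp (-‖v‖ ^ 2) / Real.sqrt Real.pi) := integrable_gauss_E1.div_const _
  have h2 : Integrable (fun v : E1 => incr (t * r) v + Real.exp (-‖v‖ ^ 2)) := (integrable_incr (t * r) ht).add integrable_gauss_E1
  rw [integral_add h1 (h2.const_mul c), integral_const_mul, integral_div, gaussian_E1, div_self hπ,
    integral_add (integrable_incr (t * r) ht) integrable_gauss_E1, gaussian_E1]
  ring

/-- [folklore] **THE SUM OF SQUARES**: for every real `λ`, pointwise in `v`,
`λ²·i_t − 2λ·i_{t+δ} + i_{t+2δ} = w·[(λ − 1)²∕√π + c·e^{trρ}·(λ − e^{δrρ})²]`. -/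
theorem density_quadratic_eq_sos (c t δ lam : ℝ) (v : E1) :
    lam ^ 2 * (Real.exp (-‖v‖ ^ 2) / Real.sqrt Real.pi + c * (incr (t * r) v + Real.exp (-‖v‖ ^ 2))) -
        2 * lam * (Real.exp (-‖v‖ ^ 2) / Real.sqrt Real.pi + c * (incr ((t + δ) * r) v + Real.exp (-‖v‖ ^ 2))) +
        (Real.exp (-‖v‖ ^ 2) / Real.sqrt Real.pi + c * (incr ((t + 2 * δ) * r) v + Real.exp (-‖v‖ ^ 2))) =
      Real.exp (-‖v‖ ^ 2) * ((lam - 1) ^ 2 / Real.sqrt Real.pi +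
        c * Real.exp (t * r * Real.exp (-(crd v ^ 2))) * (lam - Real.exp (δ * r * Real.exp (-(crd v ^ 2)))) ^ 2) := by
  rw [incr_add_gauss, incr_add_gauss, incr_add_gauss]
  have e1 : Real.exp ((t + δ) * r * Real.exp (-(crd v ^ 2))) =
      Real.exp (t * r * Real.exp (-(crd v ^ 2))) * Real.exp (δ * r * Real.exp (-(crd v ^ 2))) := by
    rw [← Real.exp_add]; ring_nf
  have e2 : Real.exp ((t + 2 * δ) * r * Real.exp (-(crd v ^ 2))) =
      Real.exp (t * r * Real.exp (-(crd v ^ 2))) * Real.exp (δ * r * Real.exp (-(crd v ^ 2))) ^ 2 := by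
    rw [← Real.exp_nat_mul, ← Real.exp_add]; congr 1; push_cast; ring
  rw [e1, e2]
  ring

/-- [folklore] The sum of squares is POSITIVE at every `v` as soon as the step is live (`0 < δ·r`) and `0 < c`. -/
theorem sos_pos {c t δ : ℝ} (hc : 0 < c) (hδ : 0 < δ * r) (lam : ℝ) (v : E1) :
    0 < Real.exp (-‖v‖ ^ 2) * ((lam - 1) ^ 2 / Real.sqrt Real.pi +
        c * Real.exp (t * r * Real.exp (-(crd v ^ 2))) * (lam - Real.exp (δ * r * Real.exp (-(crd v ^ 2)))) ^ 2) := by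
  refine mul_pos (Real.exp_pos _) ?_
  have hπ : 0 < Real.sqrt Real.pi := Real.sqrt_pos.2 Real.pi_pos
  have hA : 0 ≤ (lam - 1) ^ 2 / Real.sqrt Real.pi := div_nonneg (sq_nonneg _) hπ.le
  have hB : 0 ≤ c * Real.exp (t * r * Real.exp (-(crd v ^ 2))) * (lam - Real.exp (δ * r * Real.exp (-(crd v ^ 2)))) ^ 2 :=
    mul_nonneg (mul_nonneg hc.le (Real.exp_pos _).le) (sq_nonneg _)
  have sqpos : ∀ x : ℝ, x ≠ 0 → 0 < x ^ 2 := fun x hx => by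
    rcases lt_or_gt_of_ne hx with h | h
    · rw [sq]; exact mul_pos_of_neg_of_neg h h
    · positivity
  rcases eq_or_ne lam 1 with h1 | h1
  · -- `λ = 1`: the second square is live, `e^{δrρ} > 1`
    have hgt : 1 < Real.exp (δ * r * Real.exp (-(crd v ^ 2))) := Real.one_lt_exp_iff.2 (mul_pos hδ (Real.exp_pos _))
    have hsq : 0 < (lam - Real.exp (δ * r * Real.exp (-(crd v ^ 2)))) ^ 2 := sqpos _ (by linarith)
    linarith [mul_pos (mul_pos hc (Real.exp_pos (t * r * Real.exp (-(crd v ^ 2))))) hsq]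
  · have hsq : 0 < (lam - 1) ^ 2 := sqpos _ (sub_ne_zero.2 h1)
    linarith [div_pos hsq hπ]

/-! ## §2 STRICT MIDPOINT LOG-CONVEXITY of `1 + a` along the nonnegative real source pencil -/

/-- `0 < 1 + a(t) = 1 + cM·(√π + ∫ incr (t·r))` (`incr ≥ 0`). [folklore] -/
theorem one_add_act_pos {t : ℝ} (ht : 0 ≤ t * r) : 0 < 1 + cM r * (Real.sqrt Real.pi + ∫ v : E1, incr (t * r) v) := by
  have hI : 0 ≤ ∫ v : E1, incr (t * r) v := integral_nonneg fun v => (incr_nonneg_le (t * r) ht v).1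
  have hπ : 0 < Real.sqrt Real.pi := Real.sqrt_pos.2 Real.pi_pos
  have hc : 0 < cM r := cM_pos r
  positivity

include hr in
/-- **THE QUADRATIC FORM IS POSITIVE** [folklore]: for `0 ≤ t`, `0 < δ`, `0 < r` and every real `λ`,
`0 < λ²·(1 + a(t)) − 2λ·(1 + a(t+δ)) + (1 + a(t+2δ))` — it is the integral of the (positive, continuous, integrable) sum of squares. -/
theorem quadratic_form_pos (hr0 : 0 < r) {t δ : ℝ} (ht : 0 ≤ t) (hδ : 0 < δ) (lam : ℝ) :
    0 < lam ^ 2 * (1 + cM r * (Real.sqrt Real.pi + ∫ v : E1, incr (t * r) v)) -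
        2 * lam * (1 + cM r * (Real.sqrt Real.pi + ∫ v : E1, incr ((t + δ) * r) v)) +
        (1 + cM r * (Real.sqrt Real.pi + ∫ v : E1, incr ((t + 2 * δ) * r) v)) := by
  have h0 : 0 ≤ t * r := mul_nonneg ht hr
  have h1 : 0 ≤ (t + δ) * r := mul_nonneg (by linarith) hr
  have h2 : 0 ≤ (t + 2 * δ) * r := mul_nonneg (by linarith) hr
  have I : ∀ s : ℝ, 0 ≤ s * r →
      Integrable (fun v : E1 => Real.exp (-‖v‖ ^ 2) / Real.sqrt Real.pi + cM r * (incr (s * r) v + Real.exp (-‖v‖ ^ 2))) :=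
    fun s hs => (integrable_gauss_E1.div_const _).add (((integrable_incr (s * r) hs).add integrable_gauss_E1).const_mul _)
  -- the linear combination of the three densities, and its integral
  have hcomb : Integrable (fun v : E1 =>
      lam ^ 2 * (Real.exp (-‖v‖ ^ 2) / Real.sqrt Real.pi + cM r * (incr (t * r) v + Real.exp (-‖v‖ ^ 2))) -
        2 * lam * (Real.exp (-‖v‖ ^ 2) / Real.sqrt Real.pi + cM r * (incr ((t + δ) * r) v + Real.exp (-‖v‖ ^ 2))) +
        (Real.exp (-‖v‖ ^ 2) / Real.sqrt Real.pi + cM r * (incr ((t + 2 * δ) * r) v + Real.exp (-‖v‖ ^ 2)))) :=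
    (((I t h0).const_mul _).sub ((I (t + δ) h1).const_mul _)).add (I (t + 2 * δ) h2)
  have hint : ∫ v : E1, (lam ^ 2 * (Real.exp (-‖v‖ ^ 2) / Real.sqrt Real.pi + cM r * (incr (t * r) v + Real.exp (-‖v‖ ^ 2))) -
        2 * lam * (Real.exp (-‖v‖ ^ 2) / Real.sqrt Real.pi + cM r * (incr ((t + δ) * r) v + Real.exp (-‖v‖ ^ 2))) +
        (Real.exp (-‖v‖ ^ 2) / Real.sqrt Real.pi + cM r * (incr ((t + 2 * δ) * r) v + Real.exp (-‖v‖ ^ 2)))) =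
      lam ^ 2 * (1 + cM r * (Real.sqrt Real.pi + ∫ v : E1, incr (t * r) v)) -
        2 * lam * (1 + cM r * (Real.sqrt Real.pi + ∫ v : E1, incr ((t + δ) * r) v)) +
        (1 + cM r * (Real.sqrt Real.pi + ∫ v : E1, incr ((t + 2 * δ) * r) v)) := by
    have e1 : ∫ v : E1, (lam ^ 2 * (Real.exp (-‖v‖ ^ 2) / Real.sqrt Real.pi + cM r * (incr (t * r) v + Real.exp (-‖v‖ ^ 2))) -
        2 * lam * (Real.exp (-‖v‖ ^ 2) / Real.sqrt Real.pi + cM r * (incr ((t + δ) * r) v + Real.exp (-‖v‖ ^ 2))) +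
        (Real.exp (-‖v‖ ^ 2) / Real.sqrt Real.pi + cM r * (incr ((t + 2 * δ) * r) v + Real.exp (-‖v‖ ^ 2)))) =
        (∫ v : E1, (lam ^ 2 * (Real.exp (-‖v‖ ^ 2) / Real.sqrt Real.pi + cM r * (incr (t * r) v + Real.exp (-‖v‖ ^ 2))) -
          2 * lam * (Real.exp (-‖v‖ ^ 2) / Real.sqrt Real.pi + cM r * (incr ((t + δ) * r) v + Real.exp (-‖v‖ ^ 2))))) +
        ∫ v : E1, (Real.exp (-‖v‖ ^ 2) / Real.sqrt Real.pi + cM r * (incr ((t + 2 * δ) * r) v + Real.exp (-‖v‖ ^ 2))) :=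
      integral_add (((I t h0).const_mul _).sub ((I (t + δ) h1).const_mul _)) (I (t + 2 * δ) h2)
    have e2 : ∫ v : E1, (lam ^ 2 * (Real.exp (-‖v‖ ^ 2) / Real.sqrt Real.pi + cM r * (incr (t * r) v + Real.exp (-‖v‖ ^ 2))) -
          2 * lam * (Real.exp (-‖v‖ ^ 2) / Real.sqrt Real.pi + cM r * (incr ((t + δ) * r) v + Real.exp (-‖v‖ ^ 2)))) =
        (∫ v : E1, lam ^ 2 * (Real.exp (-‖v‖ ^ 2) / Real.sqrt Real.pi + cM r * (incr (t * r) v + Real.exp (-‖v‖ ^ 2)))) -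
        ∫ v : E1, 2 * lam * (Real.exp (-‖v‖ ^ 2) / Real.sqrt Real.pi + cM r * (incr ((t + δ) * r) v + Real.exp (-‖v‖ ^ 2))) :=
      integral_sub ((I t h0).const_mul _) ((I (t + δ) h1).const_mul _)
    rw [e1, e2, integral_const_mul, integral_const_mul, integral_density r (cM r) t h0, integral_density r (cM r) (t + δ) h1,
      integral_density r (cM r) (t + 2 * δ) h2]
  rw [← hint]
  -- the integrand IS the sum of squares, positive everywhere
  have hsos := hcomb.congr (Filter.Eventually.of_forall fun v => density_quadratic_eq_sos r (cM r) t δ lam v)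
  rw [integral_congr_ae (Filter.Eventually.of_forall fun v => density_quadratic_eq_sos r (cM r) t δ lam v)]
  have hpos : ∀ v : E1, 0 < Real.exp (-‖v‖ ^ 2) * ((lam - 1) ^ 2 / Real.sqrt Real.pi +
      cM r * Real.exp (t * r * Real.exp (-(crd v ^ 2))) * (lam - Real.exp (δ * r * Real.exp (-(crd v ^ 2)))) ^ 2) :=
    fun v => sos_pos r (cM_pos r) (mul_pos hδ hr0) lam v
  have hsupp : Function.support (fun v : E1 => Real.exp (-‖v‖ ^ 2) * ((lam - 1) ^ 2 / Real.sqrt Real.pi +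
      cM r * Real.exp (t * r * Real.exp (-(crd v ^ 2))) * (lam - Real.exp (δ * r * Real.exp (-(crd v ^ 2)))) ^ 2)) = Set.univ :=
    Set.eq_univ_of_forall fun v => (hpos v).ne'
  rw [integral_pos_iff_support_of_nonneg_ae (Filter.Eventually.of_forall fun v => (hpos v).le) hsos, hsupp]
  exact isOpen_univ.measure_pos volume Set.univ_nonempty

include hr in
/-- **STRICT MIDPOINT LOG-CONVEXITY OF `1 + a` ALONG THE NONNEGATIVE REAL SOURCE PENCIL** [decided toy]: for `0 < r`, `0 ≤ t`, `0 < δ`,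
`(1 + a(t+δ))² < (1 + a(t))·(1 + a(t+2δ))` for W35's letter-budget activity `a(s) = actM s (X₀) = cM·(√π + ∫ incr (s·r))` — the positive
quadratic form evaluated at `λ = (1 + a(t+δ))∕(1 + a(t))`. [folklore] -/
theorem strict_logConvex (hr0 : 0 < r) {t δ : ℝ} (ht : 0 ≤ t) (hδ : 0 < δ) :
    (1 + cM r * (Real.sqrt Real.pi + ∫ v : E1, incr ((t + δ) * r) v)) ^ 2 <
      (1 + cM r * (Real.sqrt Real.pi + ∫ v : E1, incr (t * r) v)) *
        (1 + cM r * (Real.sqrt Real.pi + ∫ v : E1, incr ((t + 2 * δ) * r) v)) := by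
  set A := 1 + cM r * (Real.sqrt Real.pi + ∫ v : E1, incr (t * r) v) with hA
  set B := 1 + cM r * (Real.sqrt Real.pi + ∫ v : E1, incr ((t + δ) * r) v) with hB
  set C := 1 + cM r * (Real.sqrt Real.pi + ∫ v : E1, incr ((t + 2 * δ) * r) v) with hC
  have hApos : 0 < A := one_add_act_pos r (mul_nonneg ht hr)
  have hQ := quadratic_form_pos r hr hr0 ht hδ (B / A)
  rw [← hA, ← hB, ← hC] at hQ
  have hq : (B / A) ^ 2 * A - 2 * (B / A) * B + C = C - B ^ 2 / A := by
    field_simp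
    ring
  rw [hq, sub_pos, div_lt_iff₀ hApos] at hQ
  linarith [mul_comm C A]

/-! ## §3 CONSEQUENCES ON THE TORUS OUTPUT: the second difference of `E` along the real pencil NEVER vanishes -/

open Classical in
/-- **THE SECOND DIFFERENCE OF THE DRESSED OUTPUT ALONG THE REAL SOURCE PENCIL IS NOT ZERO** [decided toy]: for `0 < r`, `0 ≤ t`,
`0 < δ`, `t + 2δ ≤ 2`, `E[actM(t+2δ)](X₀) − E[actM(t+δ)](X₀) − (E[actM(t+δ)](X₀) − E[actM t](X₀)) ≠ 0` — were it zero, W24's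
`exp_locE_cube` (`e^{E[w](X₀)} = 1 + w(X₀)` for `‖w(X₀)‖ < 1`, W35 `norm_actM_X₀_lt_one`) would give `(1 + a(t+2δ))(1 + a(t)) = (1 + a(t+δ))²`
for the REAL activities — against `strict_logConvex`.  W86's `reborn_live` is the instance `(t, δ) = (0, ¼)`. [folklore] -/
theorem second_difference_live (hr0 : 0 < r) (k : ℕ) {t δ : ℝ} (ht : 0 ≤ t) (hδ : 0 < δ) (h2 : t + 2 * δ ≤ 2) :
    locE (tgeometry 4 N).ι (tgeometry 4 N).cubes (actM N r hr k (((t + 2 * δ : ℝ)) : ℂ)) ((tgeometry 4 N).cubes (X₀ N)) -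
        locE (tgeometry 4 N).ι (tgeometry 4 N).cubes (actM N r hr k (((t + δ : ℝ)) : ℂ)) ((tgeometry 4 N).cubes (X₀ N)) -
        (locE (tgeometry 4 N).ι (tgeometry 4 N).cubes (actM N r hr k (((t + δ : ℝ)) : ℂ)) ((tgeometry 4 N).cubes (X₀ N)) -
          locE (tgeometry 4 N).ι (tgeometry 4 N).cubes (actM N r hr k ((t : ℝ) : ℂ)) ((tgeometry 4 N).cubes (X₀ N))) ≠ 0 := by
  intro h
  have hsum : locE (tgeometry 4 N).ι (tgeometry 4 N).cubes (actM N r hr k (((t + 2 * δ : ℝ)) : ℂ)) ((tgeometry 4 N).cubes (X₀ N)) +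
        locE (tgeometry 4 N).ι (tgeometry 4 N).cubes (actM N r hr k ((t : ℝ) : ℂ)) ((tgeometry 4 N).cubes (X₀ N)) =
      locE (tgeometry 4 N).ι (tgeometry 4 N).cubes (actM N r hr k (((t + δ : ℝ)) : ℂ)) ((tgeometry 4 N).cubes (X₀ N)) +
        locE (tgeometry 4 N).ι (tgeometry 4 N).cubes (actM N r hr k (((t + δ : ℝ)) : ℂ)) ((tgeometry 4 N).cubes (X₀ N)) := by
    linear_combination h
  have hn : ∀ s : ℝ, 0 ≤ s → s ≤ 2 → ‖actM N r hr k (s : ℂ) (X₀ N)‖ < 1 := fun s hs0 hs2 =>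
    norm_actM_X₀_lt_one N r hr k (by rw [Complex.norm_real, Real.norm_eq_abs, abs_of_nonneg hs0]; exact hs2)
  have hexp := congrArg cexp hsum
  rw [Complex.exp_add, Complex.exp_add] at hexp
  have hx : ∀ s : ℝ, 0 ≤ s → s ≤ 2 →
      cexp (locE (tgeometry 4 N).ι (tgeometry 4 N).cubes (actM N r hr k (s : ℂ)) ((tgeometry 4 N).cubes (X₀ N))) =
        1 + actM N r hr k (s : ℂ) (X₀ N) := fun s hs0 hs2 => exp_locE_cube N (w := actM N r hr k (s : ℂ)) (hn s hs0 hs2)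
  rw [hx _ (by linarith) h2, hx _ ht (by linarith), hx _ (by linarith) (by linarith), actM_real_X₀, actM_real_X₀, actM_real_X₀]
    at hexp
  have hreal : (1 + cM r * (Real.sqrt Real.pi + ∫ v : E1, incr ((t + 2 * δ) * r) v)) *
        (1 + cM r * (Real.sqrt Real.pi + ∫ v : E1, incr (t * r) v)) =
      (1 + cM r * (Real.sqrt Real.pi + ∫ v : E1, incr ((t + δ) * r) v)) *
        (1 + cM r * (Real.sqrt Real.pi + ∫ v : E1, incr ((t + δ) * r) v)) := by
    exact_mod_cast hexp
  have hlt := strict_logConvex r hr hr0 ht hδ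
  nlinarith [hreal, hlt]

open Classical in
/-- **W86's `reborn_live` IS THE INSTANCE `(t, δ) = (0, ¼)`** [decided toy]: the mixed difference of W86's bi-pencil datum at source step
`μ = ¼`, re-derived from `second_difference_live` (casts only). -/
example (hr0 : 0 < r) (k : ℕ) :
    locE (tgeometry 4 N).ι (tgeometry 4 N).cubes (actM N r hr k ((1 / 4 : ℂ) + 1 * (1 / 4 : ℂ))) ((tgeometry 4 N).cubes (X₀ N)) -
        locE (tgeometry 4 N).ι (tgeometry 4 N).cubes (actM N r hr k (0 + 1 * (1 / 4 : ℂ))) ((tgeometry 4 N).cubes (X₀ N)) -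
        (locE (tgeometry 4 N).ι (tgeometry 4 N).cubes (actM N r hr k ((1 / 4 : ℂ) + 0 * (1 / 4 : ℂ))) ((tgeometry 4 N).cubes (X₀ N)) -
          locE (tgeometry 4 N).ι (tgeometry 4 N).cubes (actM N r hr k (0 + 0 * (1 / 4 : ℂ))) ((tgeometry 4 N).cubes (X₀ N))) ≠ 0 := by
  have e2 : (1 / 4 : ℂ) + 1 * (1 / 4 : ℂ) = (((0 + 2 * (1 / 4) : ℝ)) : ℂ) := by push_cast; ring
  have e1 : (0 : ℂ) + 1 * (1 / 4 : ℂ) = (((0 + 1 / 4 : ℝ)) : ℂ) := by push_cast; ring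
  have e1' : (1 / 4 : ℂ) + 0 * (1 / 4 : ℂ) = (((0 + 1 / 4 : ℝ)) : ℂ) := by push_cast; ring
  have e0 : (0 : ℂ) + 0 * (1 / 4 : ℂ) = ((0 : ℝ) : ℂ) := by push_cast; ring
  rw [e2, e1, e1', e0]
  exact second_difference_live N r hr hr0 k le_rfl (by norm_num) (by norm_num)

open Classical in
/-- **THE RESPONSE OF THE `δ`-RE-BORN PART CANNOT DIE ON ANY REAL SUB-WINDOW** [decided toy]: for `0 < r`, `0 ≤ t`, `0 < δ`, `t + 2δ < 2`
it is FALSE that `∂_m (E[actM(m + t + δ)](X₀) − E[actM(m + t)](X₀)) = 0` at every `‖m‖ ≤ δ` — W101's mean value face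
`norm_mixedDiff_le_of_deriv_le` with `C = 0` would kill the second difference of `second_difference_live` (holomorphy: W51's
`analyticEnd_fires` shifted, W101 `differentiableAt_shift_sub`). [folklore] -/
theorem response_not_identically_zero_on_window (hr0 : 0 < r) (k : ℕ) {t δ : ℝ} (ht : 0 ≤ t) (hδ : 0 < δ) (h2 : t + 2 * δ < 2) :
    ¬ ∀ m : ℂ, ‖m‖ ≤ δ → deriv (fun m : ℂ =>
        locE (tgeometry 4 N).ι (tgeometry 4 N).cubes (actM N r hr k (m + (((t + δ : ℝ)) : ℂ))) ((tgeometry 4 N).cubes (X₀ N)) -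
          locE (tgeometry 4 N).ι (tgeometry 4 N).cubes (actM N r hr k (m + ((t : ℝ) : ℂ))) ((tgeometry 4 N).cubes (X₀ N))) m = 0 := by
  intro hzero
  have hf := (analyticEnd_fires N r hr (μ₁ := 2) le_rfl k).1
  have hd : ∀ m : ℂ, ‖m‖ ≤ δ → DifferentiableAt ℂ (fun m : ℂ =>
      locE (tgeometry 4 N).ι (tgeometry 4 N).cubes (actM N r hr k (m + (((t + δ : ℝ)) : ℂ))) ((tgeometry 4 N).cubes (X₀ N)) -
        locE (tgeometry 4 N).ι (tgeometry 4 N).cubes (actM N r hr k (m + ((t : ℝ) : ℂ))) ((tgeometry 4 N).cubes (X₀ N))) m := by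
    intro m hm
    refine differentiableAt_shift_sub
      (f := fun s => locE (tgeometry 4 N).ι (tgeometry 4 N).cubes (actM N r hr k s) ((tgeometry 4 N).cubes (X₀ N))) hf ?_ ?_
    · calc ‖m + (((t + δ : ℝ)) : ℂ)‖ ≤ ‖m‖ + ‖(((t + δ : ℝ)) : ℂ)‖ := norm_add_le _ _
        _ ≤ δ + (t + δ) := by
          rw [Complex.norm_real, Real.norm_eq_abs, abs_of_nonneg (by linarith)]; linarith
        _ < 2 := by linarith
    · calc ‖m + ((t : ℝ) : ℂ)‖ ≤ ‖m‖ + ‖((t : ℝ) : ℂ)‖ := norm_add_le _ _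
        _ ≤ δ + t := by rw [Complex.norm_real, Real.norm_eq_abs, abs_of_nonneg ht]; linarith
        _ < 2 := by linarith
  have h := norm_mixedDiff_le_of_deriv_le
    (A := fun m : ℂ => locE (tgeometry 4 N).ι (tgeometry 4 N).cubes (actM N r hr k (m + (((t + δ : ℝ)) : ℂ))) ((tgeometry 4 N).cubes (X₀ N)))
    (B := fun m : ℂ => locE (tgeometry 4 N).ι (tgeometry 4 N).cubes (actM N r hr k (m + ((t : ℝ) : ℂ))) ((tgeometry 4 N).cubes (X₀ N)))
    hd (C := 0) (fun m hm => by rw [hzero m hm, norm_zero]) (μ := ((δ : ℝ) : ℂ))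
    (by rw [Complex.norm_real, Real.norm_eq_abs, abs_of_pos hδ])
  rw [zero_mul] at h
  have hz := norm_le_zero_iff.1 h
  have c2 : ((δ : ℝ) : ℂ) + (((t + δ : ℝ)) : ℂ) = (((t + 2 * δ : ℝ)) : ℂ) := by push_cast; ring
  have c1 : (0 : ℂ) + (((t + δ : ℝ)) : ℂ) = (((t + δ : ℝ)) : ℂ) := by ring
  have c1' : ((δ : ℝ) : ℂ) + ((t : ℝ) : ℂ) = (((t + δ : ℝ)) : ℂ) := by push_cast; ring
  have c0 : (0 : ℂ) + ((t : ℝ) : ℂ) = ((t : ℝ) : ℂ) := by ring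
  simp only [c2, c1, c1', c0] at hz
  exact second_difference_live N r hr hr0 k ht hδ h2.le hz

end Summit.QuantumFields.BalabanUV.T4Continuum.NE1p.DressedRebornMuPartLogConvexWitness

end
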